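import Mathlib.Analysis.SpecialFunctions.Pow.Real

/-!
# `Balaban1983to89.B9Eq326ClosingBetaWindow` — T. Bałaban, *Propagators for lattice gauge theories in a background field*, Commun. Math. Phys. **99** (1985)
# 389–434 [Balaban1985BackgroundPropagators] (3.26) p. 395, (3.49) p. 399, Thm 3.11 p. 416: **THE CLOSING CONDITION OF ROAD ΔA-CT SOLVED FOR THE CONJUGATION
# PARAMETER `β` — ONE HEIGHT-FREE β-WINDOW `β ≤ β₀ := min {1, √κ₁∕(120·s_A), (γ∕4 − p_K∕2 − β_K)∕N}`, `N = 4√(C_Q∕√κ₁) + 30·s_A·C_Q∕κ₁ + 21 + 3a`, giving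
# `B9Eq326ConjugatedDeltaALetters`' window `small`, `ρ ≤ 1∕8`, and the size window `12·(β·s_A) ≤ √κ₁` at once** in the letters `C_P`, `ρ` as priced by the
# adopted suppliers (`C_P² ≤ C_Q∕√κ₁`: `B9Eq325ProjectionDivergenceQuarterKappa(Tower)`; `ρ ≤ 15·(β·s_A)∕√κ₁` on `12·(β·s_A) ≤ √κ₁`:
# `B9Eq349ConjugatedProjectionDifferenceChain(Tower)`) — the located remark L-g142-2 ∕ content N43 of the NE9 crux-ideation seat t4-ne9-idea-1 (gen 142;
# Mathlib-only SCRATCH `t4/ideate/NE9/lens1-NE9ClosingBetaWindow.lean` a4e4e34803d1540b, kernel-checked, never proposed under FREEZE (0) — CREDIT: statements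
# and proofs are theirs; this file is the def-free Literature PORT by the NE9 formalisation swarm); `β₀` is the decay rate road ΔA-CT delivers for `G₁(U)` —
# the same at every height of the tower road, since none of the seven letters carries the height

statement-level skeleton of published theorems with citation tags; proofs where landed; nothing here is a claim about the Yang–Mills mass gap

CITATION HEADER (lean-in-tree rule).  Audit cell `pub-balaban`, sub-cell `t4`, BINDER row NE9; filed by NE9 formalisation-swarm leaf prover 03
(`b2b-balaban-t4-ne9-formalise-leaf-03`, gen 75) for t4-ne9-idea-1 g142 (A-1 [NE9IDEA1-G142-W1-A1], journal 2026-08-24T18:00:22Z).  Mathlib only.  Sources READ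
first-hand: [Balaban1985BackgroundPropagators] p. 395 (3.26), p. 399 (3.49) (print's kernels decay with SOME rate `δ₀` — NOT asserted), p. 416 Thm 3.11.  Pure
real arithmetic on the road's displayed letters; nothing of print's is asserted; no number of record.

WHAT IS PROVED (sorry-free; proof lane — no `def`; [folklore] real arithmetic).
* `quad_le_lin`, `CP_le_sqrt`, `cross_le` (`2ρC_P² ≤ 30·(β·s_A)·C_Q∕κ₁`), **`small_of_beta_linear`** (DAL's `small` VERBATIM from `C_P² ≤ C_Q∕√κ₁`,
  `ρ ≤ 15(βs_A)∕√κ₁`, `0 ≤ β ≤ 1`, `β·N ≤ γ∕4 − p_K∕2 − β_K`), `rho_le_eighth_of_beta_linear`, `hwin_of_beta_linear`, `constraints_of_beta_le_beta0`,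
  `beta0_pos` (`p_K∕2 + β_K < γ∕4 ⟹ β₀ > 0`), **`closing_of_beta_le_beta0`** (`β ≤ β₀ ⟹ small ∧ ρ ≤ 1∕8 ∧ 12(βs_A) ≤ √κ₁`).
HONEST SCOPE.  Abstract; `γ, a, p_K, β_K, C_Q, κ₁, s_A` displayed; `a` (DAL) and `a′` (PDC) not identified; no number; NOT NE9 (cell pub-balaban: NE9 NOT
PRINTED ∕ NOT PROVED; «NE9 ⇐ the named binders»; row WALLED ON A MODEL (O-NE9-1; #5 UNRULED); spine PROVED 0∕9; rung (B)+1 on a finite T⁴ — NOT infinite volume,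
NOT mass gap, NOT BetaPertH, NOT Clay; HONEST DEPENDENCY: continuum YM on T⁴ ⇐ BetaPertH ∧ nine spine estimates (0/9 proved); BetaPertH ⇐ (D1) ∧ (D4) ∧
CAP+tail).  NEW file; nothing modified.  Net new unproved facts: 0.
-/

namespace Literature.MathematicalPhysics.QuantumFieldTheory.Balaban1983to89.B9Eq326ClosingBetaWindow


/-- `(21 + 3a)β² ≤ (21 + 3a)β` on `0 ≤ β ≤ 1`. [folklore] (t4-ne9-idea-1 g142 kernel D) [cite: Balaban1985BackgroundPropagators, (3.49) p.399, Thm 3.11 p.416] -/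
theorem quad_le_lin {a β : ℝ} (ha : 0 ≤ a) (hβ : 0 ≤ β) (hβ1 : β ≤ 1) : (21 + 3 * a) * β ^ 2 ≤ (21 + 3 * a) * β := by
  have h : β ^ 2 ≤ β := by nlinarith
  exact mul_le_mul_of_nonneg_left h (by linarith)

/-- The letter `C_P` from its squared supplier: `C_P ≤ √(C_Q∕√κ₁)`. [folklore] (t4-ne9-idea-1 g142 kernel D) [cite: Balaban1985BackgroundPropagators, (3.49) p.399, Thm 3.11 p.416] -/
theorem CP_le_sqrt {CP CQ κ₁ : ℝ} (hCP : 0 ≤ CP) (hCP2 : CP ^ 2 ≤ CQ / Real.sqrt κ₁) : CP ≤ Real.sqrt (CQ / Real.sqrt κ₁) := by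
  calc CP = Real.sqrt (CP ^ 2) := by rw [Real.sqrt_sq hCP]
    _ ≤ Real.sqrt (CQ / Real.sqrt κ₁) := Real.sqrt_le_sqrt hCP2

/-- The cross term priced: `2ρC_P² ≤ 30·(β·s_A)·C_Q∕κ₁`. [folklore] (t4-ne9-idea-1 g142 kernel D) [cite: Balaban1985BackgroundPropagators, (3.49) p.399, Thm 3.11 p.416] -/
theorem cross_le {ρ CP CQ κ₁ β sA : ℝ} (hκ₁ : 0 < κ₁) (hCQ : 0 ≤ CQ) (hβ : 0 ≤ β) (hsA : 0 ≤ sA)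
    (hCP2 : CP ^ 2 ≤ CQ / Real.sqrt κ₁) (hρle : ρ ≤ 15 * (β * sA) / Real.sqrt κ₁) :
    2 * ρ * CP ^ 2 ≤ 30 * (β * sA) * CQ / κ₁ := by
  have hsq : 0 < Real.sqrt κ₁ := Real.sqrt_pos.mpr hκ₁
  have hq : 0 ≤ CQ / Real.sqrt κ₁ := div_nonneg hCQ hsq.le
  have h1 : 2 * ρ * CP ^ 2 ≤ 2 * (15 * (β * sA) / Real.sqrt κ₁) * (CQ / Real.sqrt κ₁) := by
    have := mul_le_mul hρle hCP2 (sq_nonneg CP) (by positivity)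
    linarith
  have h2 : 2 * (15 * (β * sA) / Real.sqrt κ₁) * (CQ / Real.sqrt κ₁) = 30 * (β * sA) * CQ / κ₁ := by
    rw [mul_assoc, div_mul_div_comm, Real.mul_self_sqrt hκ₁.le]
    ring
  linarith

/-- **`small` FROM ONE LINEAR β-CONSTRAINT.**  DAL's window `p_K∕2 + (21 + 3a)β² + 4βC_P + 2ρC_P² + β_K ≤ γ∕4` in the letters `C_P`, `ρ`, given the
suppliers `C_P² ≤ C_Q∕√κ₁`, `ρ ≤ 15·(β·s_A)∕√κ₁`, `0 ≤ β ≤ 1` and `β·N ≤ γ∕4 − p_K∕2 − β_K` with `N = 4√(C_Q∕√κ₁) + 30·s_A·C_Q∕κ₁ + 21 + 3a`. [folklore] (t4-ne9-idea-1 g142 kernel D) [cite: Balaban1985BackgroundPropagators, (3.49) p.399, Thm 3.11 p.416] -/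
theorem small_of_beta_linear {γ a pK βK CQ κ₁ sA β CP ρ : ℝ} (ha : 0 ≤ a) (hCQ : 0 ≤ CQ) (hκ₁ : 0 < κ₁) (hsA : 0 ≤ sA)
    (hβ : 0 ≤ β) (hβ1 : β ≤ 1) (hCP : 0 ≤ CP)
    (hCP2 : CP ^ 2 ≤ CQ / Real.sqrt κ₁) (hρle : ρ ≤ 15 * (β * sA) / Real.sqrt κ₁)
    (hβN : β * (4 * Real.sqrt (CQ / Real.sqrt κ₁) + 30 * sA * CQ / κ₁ + (21 + 3 * a)) ≤ γ / 4 - pK / 2 - βK) :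
    pK / 2 + (21 + 3 * a) * β ^ 2 + 4 * β * CP + 2 * ρ * CP ^ 2 + βK ≤ γ / 4 := by
  have h1 := quad_le_lin ha hβ hβ1
  have h2 : 4 * β * CP ≤ 4 * β * Real.sqrt (CQ / Real.sqrt κ₁) :=
    mul_le_mul_of_nonneg_left (CP_le_sqrt hCP hCP2) (by positivity)
  have h3 := cross_le hκ₁ hCQ hβ hsA hCP2 hρle
  have h4 : β * (4 * Real.sqrt (CQ / Real.sqrt κ₁) + 30 * sA * CQ / κ₁ + (21 + 3 * a)) =
      4 * β * Real.sqrt (CQ / Real.sqrt κ₁) + 30 * (β * sA) * CQ / κ₁ + (21 + 3 * a) * β := by ring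
  linarith

/-- **`ρ ≤ 1∕8` FROM ONE LINEAR β-CONSTRAINT** `120·(β·s_A) ≤ √κ₁` (PDC's `ρ = (6 + 9)·(β·s_A)∕√κ₁`). [folklore] (t4-ne9-idea-1 g142 kernel D) [cite: Balaban1985BackgroundPropagators, (3.49) p.399, Thm 3.11 p.416] -/
theorem rho_le_eighth_of_beta_linear {κ₁ sA β : ℝ} (hκ₁ : 0 < κ₁) (h120 : 120 * (β * sA) ≤ Real.sqrt κ₁) :
    (6 * (β * sA) + 9 * (β * sA)) / Real.sqrt κ₁ ≤ 1 / 8 := by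
  have hsq : 0 < Real.sqrt κ₁ := Real.sqrt_pos.mpr hκ₁
  rw [div_le_iff₀ hsq]
  linarith

/-- PDC's own size window `12·(β·s_A) ≤ √κ₁` is inside the `ρ ≤ 1∕8` constraint. [folklore] (t4-ne9-idea-1 g142 kernel D) [cite: Balaban1985BackgroundPropagators, (3.49) p.399, Thm 3.11 p.416] -/
theorem hwin_of_beta_linear {κ₁ sA β : ℝ} (hβ : 0 ≤ β) (hsA : 0 ≤ sA) (h120 : 120 * (β * sA) ≤ Real.sqrt κ₁) :
    12 * (β * sA) ≤ Real.sqrt κ₁ := by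
  nlinarith [mul_nonneg hβ hsA]

/-- **THE β-WINDOW AS ONE NUMBER.**  With `s_A > 0` and `N > 0` (automatic: `N ≥ 21`), `β ≤ β₀ := min 1 (min (√κ₁∕(120·s_A)) ((γ∕4 − p_K∕2 − β_K)∕N))`
gives the three linear constraints at once; `β₀ > 0` iff the K-letters leave room, `p_K∕2 + β_K < γ∕4`. [folklore] (t4-ne9-idea-1 g142 kernel D) [cite: Balaban1985BackgroundPropagators, (3.49) p.399, Thm 3.11 p.416] -/
theorem constraints_of_beta_le_beta0 {γ a pK βK CQ κ₁ sA β : ℝ} (ha : 0 ≤ a) (hCQ : 0 ≤ CQ) (hκ₁ : 0 < κ₁) (hsA : 0 < sA)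
    (hβ0 : β ≤ min 1 (min (Real.sqrt κ₁ / (120 * sA))
      ((γ / 4 - pK / 2 - βK) / (4 * Real.sqrt (CQ / Real.sqrt κ₁) + 30 * sA * CQ / κ₁ + (21 + 3 * a))))) :
    β ≤ 1 ∧ 120 * (β * sA) ≤ Real.sqrt κ₁ ∧
      β * (4 * Real.sqrt (CQ / Real.sqrt κ₁) + 30 * sA * CQ / κ₁ + (21 + 3 * a)) ≤ γ / 4 - pK / 2 - βK := by
  have hN : 0 < 4 * Real.sqrt (CQ / Real.sqrt κ₁) + 30 * sA * CQ / κ₁ + (21 + 3 * a) := by positivity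
  refine ⟨le_trans hβ0 (min_le_left _ _), ?_, ?_⟩
  · have h := le_trans hβ0 ((min_le_right _ _).trans (min_le_left _ _))
    rw [le_div_iff₀ (by positivity)] at h
    linarith
  · have h := le_trans hβ0 ((min_le_right _ _).trans (min_le_right _ _))
    rwa [le_div_iff₀ hN] at h

/-- `β₀ > 0` exactly when the K-letters leave room. [folklore] (t4-ne9-idea-1 g142 kernel D) [cite: Balaban1985BackgroundPropagators, (3.49) p.399, Thm 3.11 p.416] -/
theorem beta0_pos {γ a pK βK CQ κ₁ sA : ℝ} (ha : 0 ≤ a) (hCQ : 0 ≤ CQ) (hκ₁ : 0 < κ₁) (hsA : 0 < sA) (hgap : pK / 2 + βK < γ / 4) :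
    0 < min 1 (min (Real.sqrt κ₁ / (120 * sA))
      ((γ / 4 - pK / 2 - βK) / (4 * Real.sqrt (CQ / Real.sqrt κ₁) + 30 * sA * CQ / κ₁ + (21 + 3 * a)))) := by
  have hN : 0 < 4 * Real.sqrt (CQ / Real.sqrt κ₁) + 30 * sA * CQ / κ₁ + (21 + 3 * a) := by positivity
  have hsq : 0 < Real.sqrt κ₁ := Real.sqrt_pos.mpr hκ₁
  refine lt_min one_pos (lt_min (by positivity) (div_pos (by linarith) hN))

/-- **CLOSING PACKAGE.**  `β ≤ β₀` ⇒ DAL's `small` ∧ `ρ ≤ 1∕8` ∧ PDC's size window, for every `C_P ≥ 0` and every `ρ` within their adopted suppliers (no sign needed on `ρ`) — the decay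
rate of road (ΔA-CT) as an explicit, height-free letter. [folklore] (t4-ne9-idea-1 g142 kernel D) [cite: Balaban1985BackgroundPropagators, (3.49) p.399, Thm 3.11 p.416] -/
theorem closing_of_beta_le_beta0 {γ a pK βK CQ κ₁ sA β CP ρ : ℝ} (ha : 0 ≤ a) (hCQ : 0 ≤ CQ) (hκ₁ : 0 < κ₁) (hsA : 0 < sA)
    (hβ : 0 ≤ β) (hCP : 0 ≤ CP)
    (hCP2 : CP ^ 2 ≤ CQ / Real.sqrt κ₁) (hρle : ρ ≤ 15 * (β * sA) / Real.sqrt κ₁)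
    (hβ0 : β ≤ min 1 (min (Real.sqrt κ₁ / (120 * sA))
      ((γ / 4 - pK / 2 - βK) / (4 * Real.sqrt (CQ / Real.sqrt κ₁) + 30 * sA * CQ / κ₁ + (21 + 3 * a))))) :
    (pK / 2 + (21 + 3 * a) * β ^ 2 + 4 * β * CP + 2 * ρ * CP ^ 2 + βK ≤ γ / 4) ∧ ρ ≤ 1 / 8 ∧ 12 * (β * sA) ≤ Real.sqrt κ₁ := by
  obtain ⟨h1, h120, hN⟩ := constraints_of_beta_le_beta0 ha hCQ hκ₁ hsA hβ0
  refine ⟨small_of_beta_linear ha hCQ hκ₁ hsA.le hβ h1 hCP hCP2 hρle hN, ?_, hwin_of_beta_linear hβ hsA.le h120⟩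
  exact hρle.trans (by
    have := rho_le_eighth_of_beta_linear (β := β) (sA := sA) hκ₁ h120
    have e : 15 * (β * sA) = 6 * (β * sA) + 9 * (β * sA) := by ring
    rw [e]; exact this)

end Literature.MathematicalPhysics.QuantumFieldTheory.Balaban1983to89.B9Eq326ClosingBetaWindow
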